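import Summits.AtomisticToContinuum.HydrodynamicLimit.Theses.KnudsenRateHorizon

/-!
# Birth skeleton (BC3) — crux `EntropyToFieldsInBand` (stmt-AtomisticToContinuum-17397), line `birth`

Route `route-AtomisticToContinuum-KnudsenRateHorizon`, crux decl
`Summit.AtomisticToContinuum.HydrodynamicLimit.Theses.KnudsenRateHorizon.EntropyToFieldsInBand :
RelEntropyVanishingInBand → _root_.HydrodynamicLimit` — the packing-guarded entropy dock (the
entropy-inequality step of Yau's relative-entropy method, run inside the dilute band; shared item, rank 9,
difficulty S: in substance the landed `Theorems.hydroLimitInBand_of_relEntropyVanishingInBand` /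
`Theorems.tendstoHydroFieldsAt_of_klDiv`).

The line (Yau 1991 §2; Kipnis–Landim 1999 Ch. 6 §1, App. 1 §8; Olla–Varadhan–Yau 1993 §3) has
exactly two substantive ingredients — the two stubs — and a quantifier-threading composition in which
THE GUARD COMMUTES WITH THE ENTROPY CLOCK (the packing hypothesis `ρ_t(x) σ³ < η₀` is passed through
unchanged: same `η₀`, same `σ₀`).

## Stubs (2; statements are the Props `Goal.stub_<name>` of §1 — informally `KlDivConcentration` and `FieldsAtTimeOfEvents` — sorries live in §2 only)

| stub | statement | size / status |
|---|---|---|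
| `stub_klDivConcentration` | `Goal.stub_klDivConcentration` (KlDivConcentration) — PROBABILISTIC ENGINE: finite measures `μ_N, ν_N` on the `(N+1)`-sphere phase spaces, arbitrary events `A_N`: `ν_N(A_N) ≤ C e^{-(N+1)/C}` and `KL(μ_N‖ν_N)/(N+1) → 0` ⟹ `μ_N(A_N) → 0` (entropy inequality for events `μ(A)·L ≤ KL + (e^L − 1)ν(A)`, `L = (N+1)/(2C)`, measurable hull) | M; provable now — it is `Theorems.tendsto_measure_of_klDiv_div_tendsto_zero` (Theorems/TwoClocksEntropyToHydro.lean) specialised to the phase spaces, closes by `exact` |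
| `stub_fieldsAtTimeOfEvents` | `Goal.stub_fieldsAtTimeOfEvents` (FieldsAtTimeOfEvents) — HARD-SPHERE PACKAGING at a fixed time `t`: if every family of events of exponentially small REFERENCE mass is asymptotically null for the LAW AT TIME `t` `(Φ_N.flow t)_* λ_N`, then exponential concentration of the three reference fields (verbatim the crux's clause) gives `TendstoHydroFieldsAt λ Φ ρ u θ t` for the INITIAL laws (transfer along the measurable flow `λ_N{z ∣ Φ_N.flow t z ∈ A} ≤ ((Φ_N.flow t)_* λ_N)(A)`; the three field events) | S; provable now (`Measure.le_map_apply`, `HardSphereFlow.measurable_flow`, `HardSphereFlow.lawAt_eq`, squeeze) |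

## Composition (§3; kernel-checked, no sorry below §2)

`EntropyToFieldsInBand_of (h₁ : Goal.stub_klDivConcentration) (h₂ : Goal.stub_fieldsAtTimeOfEvents) : EntropyToFieldsInBand`:
take `η₀, σ₀` from the hypothesis `RelEntropyVanishingInBand`, thread profiles / `σ` / the guarded
solution / `Φ` / `t < T`, obtain the reference activity `a_t` with its probability + concentration +
`klDiv/(N+1) → 0` clauses, and feed `h₂` with the event-level statement produced by `h₁` at
`μ_N := lawAt Φ_N λ_N t` (finite: push-forward of a probability measure), `ν_N :=` the reference local
Gibbs law; `h₁` is load-bearing inside `h₂`'s hypothesis, `h₂` consumes the concentration clause.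
`EntropyToFieldsInBand_of_stubs : EntropyToFieldsInBand` = `_of` applied to the two stubs (the registered
target: the crux BY NAME, no hypotheses; `sorryAx` reached exactly through `stub_*`).

## BC3 probes (registrar folder `bc/`, files import ONLY the route file; every probe FAILS as required)
`Goal.stub_klDivConcentration → crux`, `Goal.stub_klDivConcentration → _root_.HydrodynamicLimit`,
`Goal.stub_fieldsAtTimeOfEvents → crux`, `Goal.stub_fieldsAtTimeOfEvents → _root_.HydrodynamicLimit` by
`exact?` / `simpa` / `simpa [S]` / `(unfold S; simpa)` /
`aesop` (maxHeartbeats 400000): all fail ("exact? could not close the goal", "assumption failed", "aesop: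
failed to prove the goal after exhaustive search"); extra: neither stub alone closes by the same battery.

## Disproof / negatives used
None relevant: no `Disproof.lean`, idea or line existed for this crux at registration (crux dir empty,
2026-08-17); the crux carries "no research risk" in the route file.

## Registration
`ledger skeleton check <this file> --crux stmt-AtomisticToContinuum-17397 --crux-decl
Summit.AtomisticToContinuum.HydrodynamicLimit.Theses.KnudsenRateHorizon.EntropyToFieldsInBand` (the item is
shared by six routes under different decl names; this skeleton concludes the KnudsenRateHorizon copy — pass the
`--crux-decl`, the CLI default is the first wanting route's copy). The stub statements are named
`Goal.stub_<name>` so that the hypotheses of `EntropyToFieldsInBand_of` are admissible for `#h21_check_skeleton`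
BY NAME (last component = the registered stub), whichever crux-concluding theorem the audit enumerates first;
no gate-reserved `@[stub]` attribute is used.

planner-skel-stmt-AtomisticToContinuum-17397-0 (skeleton-register, 2026-08-17).
-/

noncomputable section

open MeasureTheory Filter Set Topology InformationTheory
open scoped ENNReal

namespace Summit.AtomisticToContinuum.HydrodynamicLimit.Cruxes.EntropyToFieldsInBand.Birth

open Literature.MathematicalPhysics.KineticTheory

/-! ## §1 Stub statements (plain `Prop`s `Goal.stub_<name>` over tree vocabulary; the admissible hypotheses of `EntropyToFieldsInBand_of`) -/

/-- **Goal of stub 1, `KlDivConcentration` — the probabilistic engine (relative entropy `o(N)` + exponential reference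
concentration ⟹ vanishing probability).** For finite measures `μ_N, ν_N` on the `(N+1)`-sphere phase
spaces and ARBITRARY events `A_N`: `ν_N(A_N) ≤ C e^{-(N+1)/C}` for all `N` and
`KL(μ_N ‖ ν_N)/(N+1) → 0` imply `μ_N(A_N) → 0`. Entropy inequality for events
`μ(A)·L ≤ KL(μ‖ν) + (e^L − 1)·ν(A)` (Fenchel–Young half of the Donsker–Varadhan formula tested on
`L·𝟙_A`, on the `ν_N`-measurable hull of `A_N`) with `L_N = (N+1)/(2C)`:
`μ_N(A_N) ≤ 2C·KL_N/(N+1) + 2C²e^{-(N+1)/(2C)} → 0`; `KL = ∞` at small `N` is harmless.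
Leans on: `Literature.Probability.Divergences.integral_le_toReal_klDiv_add_integral`; in the tree as
`Theorems.tendsto_measure_of_klDiv_div_tendsto_zero`.
[cite: KipnisLandim1999, Ch. 6 §1; App. 1 §8] [cite: Yau1991, §2] -/
def Goal.stub_klDivConcentration : Prop :=
  ∀ (μ ν : (N : ℕ) → Measure (Literature.Analysis.FluidPDE.Config (N + 1) (Fin 3) T3)),
    (∀ N, IsFiniteMeasure (μ N)) → (∀ N, IsFiniteMeasure (ν N)) →
    ∀ (A : (N : ℕ) → Set (Literature.Analysis.FluidPDE.Config (N + 1) (Fin 3) T3)) (C : ℝ),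
      0 < C →
      (∀ N : ℕ, ν N (A N) ≤ ENNReal.ofReal (C * Real.exp (-(C⁻¹ * ((N : ℝ) + 1))))) →
      Tendsto (fun N : ℕ => klDiv (μ N) (ν N) / ((N : ℝ≥0∞) + 1)) atTop (𝓝 0) →
      Tendsto (fun N : ℕ => μ N (A N)) atTop (𝓝 0)

/-- **Goal of stub 2, `FieldsAtTimeOfEvents` — the hard-sphere packaging at a fixed time (events under the law at
time `t` ⟹ fields under the initial law).** For a family of hard-sphere flows `Φ_N` at reduced density
`σ`, initial local Gibbs laws `λ_N = localGibbsLaw σ a₀ u₀ θ₀ N Φ_N`, a reference profile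
`(a, u_t, θ_t)` and a time `t`: IF for every `C > 0` and every family of events `A_N` with reference
mass `≤ C e^{-(N+1)/C}` the law at time `t` satisfies `((Φ_N.flow t)_* λ_N)(A_N) → 0`, THEN
exponential concentration of the reference density / momentum / energy fields around `(ρ, ρu, E)(t)`
(verbatim the clause of `RelEntropyVanishingInBand`) gives `TendstoHydroFieldsAt λ Φ ρ u θ t`.
Content: the transfer along the measurable flow `λ_N{z | Φ_N.flow t z ∈ A} ≤ ((Φ_N.flow t)_* λ_N)(A)`
(`Measure.le_map_apply`, `HardSphereFlow.measurable_flow`, `HardSphereFlow.lawAt_eq`; no measurability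
of the deviation events needed) and the identification of the three field events of
`TendstoHydroFieldsAt`. [cite: Yau1991, §2] [cite: OllaVaradhanYau1993, §1] -/
def Goal.stub_fieldsAtTimeOfEvents : Prop :=
  ∀ (σ : ℝ) (a₀ θ₀ a : T3 → ℝ) (u₀ : T3 → V3) (ρ θ : ℝ → T3 → ℝ) (u : ℝ → T3 → V3) (t : ℝ)
    (Φ : (N : ℕ) → Literature.Analysis.FluidPDE.HardSphereFlow
      (Literature.Analysis.FluidPDE.Torus.geometry (Fin 3)) (hsDiameter σ N) (N + 1)),
    (∀ C : ℝ, 0 < C →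
      ∀ A : (N : ℕ) → Set (Literature.Analysis.FluidPDE.Config (N + 1) (Fin 3) T3),
        (∀ N : ℕ, localGibbsLaw σ a (u t) (θ t) N (Φ N) (A N) ≤
          ENNReal.ofReal (C * Real.exp (-(C⁻¹ * ((N : ℝ) + 1))))) →
        Tendsto (fun N : ℕ => (Φ N).lawAt (localGibbsLaw σ a₀ u₀ θ₀ N (Φ N)) t (A N))
          atTop (𝓝 0)) →
    (∀ χ : T3 → ℝ, Continuous χ → ∀ δ : ℝ, 0 < δ → ∃ C : ℝ, 0 < C ∧ ∀ N : ℕ,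
      localGibbsLaw σ a (u t) (θ t) N (Φ N)
          {z | δ < |empiricalDensityField z χ - ∫ x, χ x * ρ t x|} ≤
        ENNReal.ofReal (C * Real.exp (-(C⁻¹ * (N + 1)))) ∧
      localGibbsLaw σ a (u t) (θ t) N (Φ N)
          {z | δ < ‖empiricalMomentumField z χ - ∫ x, (χ x * ρ t x) • u t x‖} ≤
        ENNReal.ofReal (C * Real.exp (-(C⁻¹ * (N + 1)))) ∧
      localGibbsLaw σ a (u t) (θ t) N (Φ N)
          {z | δ < |empiricalEnergyField z χ -
            ∫ x, χ x * totalEnergyDensity (ρ t x) (u t x) (θ t x)|} ≤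
        ENNReal.ofReal (C * Real.exp (-(C⁻¹ * (N + 1))))) →
    TendstoHydroFieldsAt (fun N => localGibbsLaw σ a₀ u₀ θ₀ N (Φ N)) Φ ρ u θ t

/-! ## §2 Stubs (the ONLY sorries of the file) -/

/-- Stub 1 (M; provable now — `Theorems.tendsto_measure_of_klDiv_div_tendsto_zero`): the probabilistic
engine. -/
theorem stub_klDivConcentration : Goal.stub_klDivConcentration := by
  sorry

/-- Stub 2 (S; provable now — transfer along the measurable flow + the three field events): the
hard-sphere packaging at a fixed time. -/
theorem stub_fieldsAtTimeOfEvents : Goal.stub_fieldsAtTimeOfEvents := by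
  sorry

/-! ## §3 Composition (kernel-checked; no sorry below this line) -/

/-- **The line closes the crux modulo its two stubs** (`EntropyToFieldsInBand` BY NAME; real proof,
axioms `propext`/`Classical.choice`/`Quot.sound` only). Take `η₀` and `σ₀` from the hypothesis
`RelEntropyVanishingInBand`; for `σ < σ₀`, a classical solution obeying the packing guard, a flow family
`Φ`, convergence at `t = 0` and `t < T`, obtain the reference activity `a_t` (probability, exponential
concentration, `klDiv/(N+1) → 0`) and apply `h₂`, whose event-level hypothesis is `h₁` at
`μ_N := lawAt Φ_N λ_N t` (finite: push-forward of the probability measure `λ_N` along the measurable map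
`Φ_N.flow t`) and `ν_N :=` the reference local Gibbs law. Both hypotheses are load-bearing.
[cite: Yau1991, §2] [cite: KipnisLandim1999, Ch. 6 §1] -/
theorem EntropyToFieldsInBand_of (h₁ : Goal.stub_klDivConcentration) (h₂ : Goal.stub_fieldsAtTimeOfEvents) :
    Summit.AtomisticToContinuum.HydrodynamicLimit.Theses.KnudsenRateHorizon.EntropyToFieldsInBand := by
  intro hRE
  obtain ⟨η₀, hη₀, H⟩ := hRE
  refine ⟨η₀, hη₀, fun a₀ θ₀ u₀ ha hθ hu ha0 hθ0 => ?_⟩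
  obtain ⟨σ₀, hσ₀, G⟩ := H a₀ θ₀ u₀ ha hθ hu ha0 hθ0
  refine ⟨σ₀, hσ₀, fun σ hσ hσ' T ρ θ u hE hguard Φ h0 t ht => ?_⟩
  obtain ⟨hprob, hmain⟩ := G σ hσ hσ' T ρ θ u hE hguard Φ
  obtain ⟨a, hψ, hconc, hkl⟩ := hmain h0 t ht
  refine h₂ σ a₀ θ₀ a u₀ ρ θ u t Φ (fun C hC A hA => ?_) hconc
  have hfinμ : ∀ N : ℕ, IsFiniteMeasure ((Φ N).lawAt (localGibbsLaw σ a₀ u₀ θ₀ N (Φ N)) t) := by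
    intro N
    haveI := hprob N
    rw [Literature.Analysis.FluidPDE.HardSphereFlow.lawAt_eq]
    infer_instance
  have hfinν : ∀ N : ℕ, IsFiniteMeasure (localGibbsLaw σ a (u t) (θ t) N (Φ N)) := by
    intro N
    haveI := hψ N
    infer_instance
  exact h₁ (fun N => (Φ N).lawAt (localGibbsLaw σ a₀ u₀ θ₀ N (Φ N)) t)
    (fun N => localGibbsLaw σ a (u t) (θ t) N (Φ N)) hfinμ hfinν A C hC hA hkl

/-- **Registered target of the skeleton** — the crux BY NAME with no hypotheses:
`EntropyToFieldsInBand_of` applied to the two declared stubs (the sorries live in `stub_*` only;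
`#print axioms` of this theorem reaches `sorryAx` exactly through them). [cite: Yau1991, §2] -/
theorem EntropyToFieldsInBand_of_stubs :
    Summit.AtomisticToContinuum.HydrodynamicLimit.Theses.KnudsenRateHorizon.EntropyToFieldsInBand :=
  EntropyToFieldsInBand_of stub_klDivConcentration stub_fieldsAtTimeOfEvents

end Summit.AtomisticToContinuum.HydrodynamicLimit.Cruxes.EntropyToFieldsInBand.Birth

end
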